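import Summits.PneNP.PneNP.Theorems.RootDecompSegregatorSmallSegregators.Negative.KSS6
import Summits.PneNP.PneNP.Theses.RootDecompSegregator

/-!
# Refutation of the aside `RootDecompSegregator.SmallSegregatorsAt3` (stmt-PneNP-27086)

`SmallSegregatorsAt3` is the `r = 3` instance of Santhanam's small-segregator hypothesis, verbatim the
body of `RootDecompSegregator.SmallSegregators` at `Fin 3`; it unfolds definitionally to
`RootDecompSegregatorSmallSegregators.Negative.SmallSegregatorsAt 3`, which the K\*\* cone refutes
(`not_smallSegregatorsAt_of_ancestorRobust ancestorRobust_three`, files `Negative/Defs.lean`,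
`Negative/KSS1.lean` … `Negative/KSS6.lean`).  Same witness and classification as
`RootDecompSegregatorSmallSegregators_refuted` (triple-stack butterfly, `r = 3`, `k = 172`).

PROVENANCE: decomp-pnenp lens-1 (`SegregatorPageThreshold.lean` v5, sha256 `099856e2…`), cone landed by
the cell critic.  0 sorry; axioms `propext`, `Classical.choice`, `Quot.sound`.
-/

namespace Summit.PneNP.PneNP.Theorems

open RootDecompSegregatorSmallSegregators.Negative in
/-- Refutes `RootDecompSegregator.SmallSegregatorsAt3` [refuted-substantive]: the `r = 3` small-segregator
hypothesis fails at `k = 172`; witness: the triple-stack butterfly step graphs `TSB.tbGraph L`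
(`N = 10·2^L·L + 2·2^L`, `AncestorRobust 3 160 12`): every `J` with `173·|J|·(log₂ N + 1) ≤ N` leaves a
vertex with more than `N/173` `J`-avoiding ancestors.  No cheap repair (the aside IS the intended `r = 3`
instance; the strict PPST class and the literal `(o(n), o(n/log n))` budgets are bitten by the same
family); barrier-candidate: constant-page ancestor-robustness. -/
theorem RootDecompSegregatorSmallSegregatorsAt3_refuted :
    ¬ Summit.PneNP.PneNP.Theses.RootDecompSegregator.SmallSegregatorsAt3 :=
  fun hS => not_smallSegregatorsAt_of_ancestorRobust ancestorRobust_three hS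

end Summit.PneNP.PneNP.Theorems
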